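import Literature.MeasureTheory.Group.InvariantQuotientAdaptedUnfoldingBound             -- ★ p849197 (this seat, file 1): adapted unfolding, finiteness along a contracting element, integrability from finite orbit-preimages
import Literature.NumberTheory.Rogawski1990.UnipotentLevelPiecesFrameCM                   -- ★ p846498: the one-place frame `ψ` (`exists_conj_localNonsplitEquiv_eq`, `mem_cmLocalIntegralLevel_iff_isIntMatrix_conj`, `continuous_conj_localNonsplitEquiv_apply`)
import Literature.NumberTheory.Automorphic.UnitaryThreeUnipotentCentralizers                -- ★ `mul_cornerUnipotent_eq_cornerUnipotent_mul_iff`, `diagonal_mem_unitaryGroupOfForm_three_iff`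
import Literature.NumberTheory.Automorphic.UnitaryGroupCMLocalIwasawa                       -- ★ `exists_mem_cmLocalIntegralLevel_mul_borel` (`G = K·B`, every finite place)
import Literature.NumberTheory.Automorphic.LocalUnitaryGroupUnimodularOfAdelic              -- ★ `isMulRightInvariant_cmDatum_local_of_adelic`
import Literature.NumberTheory.Automorphic.AdelicUnitaryGroupUnimodularIsotropic            -- ★ `modularCharacter_cmDatum_eq_one_of_isotropic`
import Literature.NumberTheory.Automorphic.LocalOrbitalMeasure                              -- ★ `isClosed_coe_centralizer_singleton`
import Literature.NumberTheory.Rogawski1990.ExplicitFactorKappaAlmostEverywhereOne          -- ★ `smul_placesOver_eq_of_subsingleton`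
import Literature.NumberTheory.Rogawski1990.LocalTransferFundamentalLemma                   -- ★ `IsLocSmooth`
import Literature.NumberTheory.Automorphic.FiniteAdeleFactorizable                           -- ★ `isClopen_setOf_valued_le` (closed valuation balls of `L_w` are clopen)
import Literature.NumberTheory.Automorphic.UnitaryThreeSingularUnipotentClasses             -- ★ `exists_units_coe_eq_torusElt`, `torusElt_mem_unitaryGroupOfForm`, `coe_torusElt_conj_cornerUnipotent`, `mem_unitaryGroupOfForm_iff_of_coe_eq_cornerUnipotent`
import HarnessLib

/-!
# Convergence of the orbital integrals at the TRANSVECTION classes of `U(Φ₃)(L⁺_v)` (Ranga Rao's theorem, singular unipotent case):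
# `μ{y C(u) ∣ y u y⁻¹ ∈ C} < ∞` for every compact `C` and every invariant Radon `μ` on `G ⧸ C(u)`, `u ∼ n(t₀)`

Topic `NumberTheory/Rogawski1990`; namespace `Literature.NumberTheory.Rogawski1990` (§1 in `Literature.NumberTheory.Automorphic.UnitaryGroup`).  THEOREMS ONLY (no
definition, no instance, no notation, no named fact, no `sorry`).  Cell `pub/hodgecm-mathlib` (D-0151), crux H413 = `stmt-HodgeConjecture-24833`, F0∕P3c line LH4 (Shalika
pay-down of the closer row `stub_N6nsShalika`), organ **RAO-CONV** = clause (iii) of `stub_ShRao` of the LH4 pay-down skeleton cand `StubN6nsShalika.paydown.skeleton.v1`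
(LH4-plan (g2), a42538b59ca1b043 :111–:128): «for every unipotent class `u` and every `f ∈ C_c^∞(G)`, `y ↦ f(y u y⁻¹)` is `mU u`-integrable».  THIS FILE: the transvection
classes (`(u − 1)² = 0`, `u ≠ 1`), at EVERY non-split place (no parity, no `v ∤ 2` hypothesis), for EVERY `G`-invariant measure on `G ⧸ C(u)` finite on compacta (so the
organ's `mU u` plugs in by its admissibility conjuncts).  File 1 = ★ `InvariantQuotientAdaptedUnfoldingBound` (generic); file 3 = the regular class; file 4 = assembly.

THE MATHEMATICS (road (α′) of the census memo `RAO-CONV.census.F0P3ap09g4.md`; [Rao1972] is the print shadow).  `G = U(Φ₃)(L⁺_v)` read in the one-place model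
`ψ = e : G ≃ U(σ_w, J₀)(L_w)` (★ `localNonsplitEquiv`; the frame of `Φ₃` is the identity, ★ `placeForm_antidiagOne`), `K = U(Φ₃)(𝒪_v)` (★ `cmLocalIntegralLevel`, compact open,
`= {y ∣ ψ y integral}`), `u = ψ⁻¹ n(t₀)`, `n(t) = 1 + t E₀₂`, `a = ψ⁻¹ d(ϖ)`, `d(z) = diag(z, 1, (σz)⁻¹)`, `ϖ` a uniformiser of `L_w`.
* §1 (field level, `U(σ, J₀)(K) ≤ GL₃(K)`): an upper-triangular unitary `h` conjugates `n(t)` to `n(t·h₀₀·σh₀₀)` (★ `conj_cornerUnipotent_sub_one_apply`); its diagonal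
  satisfies `σh₂₂·h₀₀ = 1 = σh₁₁·h₁₁`; the COMMUTATION CRITERION ★ `g n(t) = n(t) g ↔ g₁₀ = g₂₀ = g₂₁ = 0 ∧ g₀₀ = g₂₂` is invariant under diagonal conjugation, and
  `d(ϖ)`-conjugation IMPROVES integrality of such `g` (entries are multiplied by `1, ϖ, ϖσϖ, σϖ`).
* §2 (the covering, from the Iwasawa decomposition ★ `G = K·B` used SET-THEORETICALLY): for every compact `C ⊆ G`,
  `{y ∣ y u y⁻¹ ∈ C} ⊆ ⋃_{m ≥ 0} K a^m C(u) ∪ ⋃_{0 < n ≤ n_C} K g_n C(u)` with `ψ g_n = d(ϖ^{−n})`: write `y = κ h` (`κ ∈ K`, `h ∈ B`); `ψ(h u h⁻¹) = n(N(h₀₀) t₀)` lies in the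
  compact `ψ(K C K)`, whose `(0,2)`-entries have bounded valuation, so `|h₀₀| = |ϖ|^{−n}` with `n ≤ n_C`; then `h = d₀ · g · n′` with `ψ d₀ = diag(h₀₀ ϖ^{n}, h₁₁, h₂₂ σϖ^{−n})`
  INTEGRAL (`∈ K`), `g = a^{−n}` or `g_n`, and `n′ = (d₀ g)⁻¹ h` upper unitriangular, hence in `C(u)`.
* §3 (the measure bound): `a` normalises `C(u)` (criterion), `Ad(a)` improves `K`-integrality on `C(u)` (§1) STRICTLY (`ψ⁻¹ n(s)`, `s` skew with `1 < |s| ≤ |ϖ|^{−2}`), so ★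
  `measure_iUnion_image_mk_mul_zpow_lt_top` (file 1; `ρ` = a Haar measure of `C(u)`, `ν` = a Haar measure of `G`, right invariant by ★ unimodularity of `U(Φ₃)(L⁺_v)`) bounds the
  `m ≥ 0` part and ★ `measure_image_mk_mul_singleton_lt_top` the finitely many `g_n`: **`measure_preimage_descConj_lt_top_of_coe_eq_cornerUnipotent`**.  By ★
  `integrable_descConj_of_measure_preimage_lt_top` every `f ∈ C_c^∞(G)` then has an integrable orbital integrand (`integrable_descConj_of_isLocSmooth_of_coe_eq_cornerUnipotent`);
  the transport along `y ↦ y g⁻¹` (★ `cosetCongr`) to EVERY `γ` with `(γ − 1)² = 0`, `γ ≠ 1` (★ `exists_conj_coe_eq_cornerUnipotent_of_sq_eq_zero`) is file 4's assembly.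
HONEST LABEL: count-neutral ★ brick (`--supports stmt-HodgeConjecture-24833`); HC_CM is proved only modulo the 7 printed citations (2 remaining: hLiu418 =
stmt-HodgeConjecture-24832, h413 = stmt-HodgeConjecture-24833) until rung 0 closes; the organ `stub_ShRao` closes only with files 3–4 and RAO-EX ∕ CENT-BDD.

## References
* [Rao1972] R. Ranga Rao, *Orbital integrals in reductive groups*, Ann. of Math. (2) 96 (1972) 505–510, Theorem p. 505.
* [Rogawski1990] J. D. Rogawski, *Automorphic Representations of Unitary Groups in Three Variables*, Ann. of Math. Stud. 123 (1990): §1.10 p. 9 (`B = MN`, `n(t)`, `d(z)`),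
  §3.9 p. 32 (`G_{n(t)} = S·N`), §4.9 p. 54, §8.1 p. 112 (unipotent orbital integrals).
* [HarishChandra1999AdmissibleDistributions] Harish-Chandra, *Admissible Invariant Distributions on Reductive p-adic Groups*, AMS ULS 16 (1999), §3.1 p. 17.
* [BruhatTits1972] F. Bruhat, J. Tits, *Groupes réductifs sur un corps local I*, Publ. Math. IHÉS 41 (1972), (4.4.3) (Iwasawa decomposition).
-/

set_option autoImplicit false

noncomputable section

open scoped Matrix MatrixGroups Valued WithZero ENNReal Pointwise
open Matrix MeasureTheory Topology Set NumberField IsDedekindDomain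

/-! ## §1 Field level: upper-triangular unitary matrices against the corner transvection `n(t)` -/

namespace Literature.NumberTheory.Automorphic.UnitaryGroup

open Literature.NumberTheory.Automorphic.HermitianLattice Literature.NumberTheory.Automorphic.UnitaryLatticeTree

section Field

variable {K : Type*} [Field K] (σ : K →+* K)

/-- **An upper-triangular unitary matrix conjugates `n(t)` to `n(t·h₀₀·σh₀₀)`**: for `h ∈ U(σ, J₀)` with `h₁₀ = h₂₀ = 0`, `h n(t) h⁻¹ = n(t h₀₀ σ(h₀₀))`
(★ `conj_cornerUnipotent_sub_one_apply`: `(h n(t) h⁻¹ − 1)_{ij} = t h_{i0} σ(h_{rev j,0})`). [cite: Rogawski1990, §1.10 p. 9; §3.9 p. 32] -/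
theorem coe_conj_cornerUnipotent_of_apply_zero_eq_zero {t : K} {u h : GL (Fin 3) K}
    (hu : (u : Matrix (Fin 3) (Fin 3) K) = !![1, 0, t; 0, 1, 0; 0, 0, 1])
    (hh : h ∈ unitaryGroupOfForm σ ((StdForm.antidiagonal 3).over K))
    (h10 : (h : Matrix (Fin 3) (Fin 3) K) 1 0 = 0) (h20 : (h : Matrix (Fin 3) (Fin 3) K) 2 0 = 0) :
    ((h * u * h⁻¹ : GL (Fin 3) K) : Matrix (Fin 3) (Fin 3) K) =
      !![1, 0, t * (h : Matrix (Fin 3) (Fin 3) K) 0 0 * σ ((h : Matrix (Fin 3) (Fin 3) K) 0 0); 0, 1, 0; 0, 0, 1] := by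
  ext i j
  have e := conj_cornerUnipotent_sub_one_apply σ hu hh i j
  rw [Matrix.sub_apply, sub_eq_iff_eq_add] at e
  rw [e]
  have r0 : Fin.rev (0 : Fin 3) = 2 := rfl
  have r1 : Fin.rev (1 : Fin 3) = 1 := rfl
  have r2 : Fin.rev (2 : Fin 3) = 0 := rfl
  fin_cases i <;> fin_cases j <;> simp [r0, r1, r2, h10, h20]

/-- **The diagonal of an upper-triangular unitary matrix** (form `J₀ = antidiag(1,1,1)`): `σ(h₂₂)·h₀₀ = 1` and `σ(h₁₁)·h₁₁ = 1` — read `B₀(h e₀, h e₂) = B₀(e₀, e₂) = 1`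
and `B₀(h e₁, h e₁) = 1` with `h e₀ = h₀₀ e₀`, `h e₁ = h₀₁ e₀ + h₁₁ e₁`. [cite: Rogawski1990, §1.10 p. 9] -/
theorem diag_rel_of_upper_mem_unitaryGroupOfForm {h : GL (Fin 3) K} (hh : h ∈ unitaryGroupOfForm σ ((StdForm.antidiagonal 3).over K))
    (h10 : (h : Matrix (Fin 3) (Fin 3) K) 1 0 = 0) (h20 : (h : Matrix (Fin 3) (Fin 3) K) 2 0 = 0) (h21 : (h : Matrix (Fin 3) (Fin 3) K) 2 1 = 0) :
    σ ((h : Matrix (Fin 3) (Fin 3) K) 2 2) * (h : Matrix (Fin 3) (Fin 3) K) 0 0 = 1 ∧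
      σ ((h : Matrix (Fin 3) (Fin 3) K) 1 1) * (h : Matrix (Fin 3) (Fin 3) K) 1 1 = 1 := by
  rw [mem_unitaryGroupOfForm_antidiagonal_iff] at hh
  have hcol : ∀ j i : Fin 3, ((h : Matrix (Fin 3) (Fin 3) K).mulVec (Pi.single j 1)) i = (h : Matrix (Fin 3) (Fin 3) K) i j := by
    intro j i; rw [Matrix.mulVec_single_one]; rfl
  have hB : ∀ x y : Fin 3 → K, B₀ σ 3 x y = σ (x 0) * y 2 + σ (x 1) * y 1 + σ (x 2) * y 0 := B₀_three_apply σ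
  constructor
  · have e := hh (Pi.single 2 1) (Pi.single 0 1)
    rw [hB, hB, hcol, hcol, hcol, hcol, hcol, hcol, h10, h20] at e
    simpa using e
  · have e := hh (Pi.single 1 1) (Pi.single 1 1)
    rw [hB, hB, hcol, hcol, hcol, h21] at e
    simpa using e

/-- A diagonal invertible matrix `diag(α, β, γ)` with its inverse, as a unit. [folklore] -/
private theorem exists_units_coe_eq_diagonal₃ {α β γ : K} (hα : α ≠ 0) (hβ : β ≠ 0) (hγ : γ ≠ 0) :
    ∃ d : GL (Fin 3) K, (d : Matrix (Fin 3) (Fin 3) K) = Matrix.diagonal ![α, β, γ] ∧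
      ((d⁻¹ : GL (Fin 3) K) : Matrix (Fin 3) (Fin 3) K) = Matrix.diagonal ![α⁻¹, β⁻¹, γ⁻¹] := by
  have h1 : Matrix.diagonal ![α, β, γ] * Matrix.diagonal ![α⁻¹, β⁻¹, γ⁻¹] = 1 := by
    rw [Matrix.diagonal_mul_diagonal, ← Matrix.diagonal_one]
    congr 1; funext i; fin_cases i <;> simp [mul_inv_cancel₀ hα, mul_inv_cancel₀ hβ, mul_inv_cancel₀ hγ]
  have h2 : Matrix.diagonal ![α⁻¹, β⁻¹, γ⁻¹] * Matrix.diagonal ![α, β, γ] = 1 := by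
    rw [Matrix.diagonal_mul_diagonal, ← Matrix.diagonal_one]
    congr 1; funext i; fin_cases i <;> simp [inv_mul_cancel₀ hα, inv_mul_cancel₀ hβ, inv_mul_cancel₀ hγ]
  exact ⟨⟨_, _, h1, h2⟩, rfl, rfl⟩

/-- Entries of a diagonal conjugate: `(D g D⁻¹)_{ij} = D_i g_{ij} D_j⁻¹` for `D = diag(α, β, γ)`. [folklore] -/
private theorem diagonal_conj_apply {α β γ : K} {d : GL (Fin 3) K} (hd : (d : Matrix (Fin 3) (Fin 3) K) = Matrix.diagonal ![α, β, γ])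
    (hd' : ((d⁻¹ : GL (Fin 3) K) : Matrix (Fin 3) (Fin 3) K) = Matrix.diagonal ![α⁻¹, β⁻¹, γ⁻¹]) (g : Matrix (Fin 3) (Fin 3) K) (i j : Fin 3) :
    ((d : Matrix (Fin 3) (Fin 3) K) * g * ((d⁻¹ : GL (Fin 3) K) : Matrix (Fin 3) (Fin 3) K)) i j = ![α, β, γ] i * g i j * (![α, β, γ] j)⁻¹ := by
  rw [hd, hd']
  fin_cases i <;> fin_cases j <;> simp [Matrix.mul_apply, Matrix.diagonal]

/-- **The commutation criterion with `n(t)` is invariant under diagonal conjugation**: for `D = diag(α, β, γ)` invertible, `g` satisfies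
`g₁₀ = g₂₀ = g₂₁ = 0 ∧ g₀₀ = g₂₂` iff `D g D⁻¹` does (the entries are rescaled by `D_i D_j⁻¹`, the two diagonal ones unchanged). [cite: Rogawski1990, §3.9 p. 32] -/
theorem cornerCriterion_conj_diagonal_iff {α β γ : K} {d : GL (Fin 3) K} (hd : (d : Matrix (Fin 3) (Fin 3) K) = Matrix.diagonal ![α, β, γ])
    (hd' : ((d⁻¹ : GL (Fin 3) K) : Matrix (Fin 3) (Fin 3) K) = Matrix.diagonal ![α⁻¹, β⁻¹, γ⁻¹])
    (hα : α ≠ 0) (hβ : β ≠ 0) (hγ : γ ≠ 0) (g : Matrix (Fin 3) (Fin 3) K) :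
    (g 1 0 = 0 ∧ g 2 0 = 0 ∧ g 2 1 = 0 ∧ g 0 0 = g 2 2) ↔
      (((d : Matrix (Fin 3) (Fin 3) K) * g * ((d⁻¹ : GL (Fin 3) K) : Matrix (Fin 3) (Fin 3) K)) 1 0 = 0 ∧
        ((d : Matrix (Fin 3) (Fin 3) K) * g * ((d⁻¹ : GL (Fin 3) K) : Matrix (Fin 3) (Fin 3) K)) 2 0 = 0 ∧
        ((d : Matrix (Fin 3) (Fin 3) K) * g * ((d⁻¹ : GL (Fin 3) K) : Matrix (Fin 3) (Fin 3) K)) 2 1 = 0 ∧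
        ((d : Matrix (Fin 3) (Fin 3) K) * g * ((d⁻¹ : GL (Fin 3) K) : Matrix (Fin 3) (Fin 3) K)) 0 0 =
          ((d : Matrix (Fin 3) (Fin 3) K) * g * ((d⁻¹ : GL (Fin 3) K) : Matrix (Fin 3) (Fin 3) K)) 2 2) := by
  simp only [diagonal_conj_apply hd hd']
  have e0 : (![α, β, γ] : Fin 3 → K) 0 = α := rfl
  have e1 : (![α, β, γ] : Fin 3 → K) 1 = β := rfl
  have e2 : (![α, β, γ] : Fin 3 → K) 2 = γ := rfl
  have key : ∀ {c : K}, c ≠ 0 → ∀ x : K, c * x * c⁻¹ = x := fun hc x => by field_simp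
  simp only [e0, e1, e2, mul_eq_zero, inv_eq_zero, hα, hβ, hγ, or_false, false_or, key hα, key hγ]

end Field

section ValuedField

variable {K : Type*} [Field K] [Valued K ℤᵐ⁰] (σ : K →+* K)

omit [Valued K ℤᵐ⁰] in
/-- **`d(ϖ)`-conjugation on the centraliser of `n(t)`, entrywise**: for `g` with `g₁₀ = g₂₀ = g₂₁ = 0`,
`d(ϖ) g d(ϖ)⁻¹ = (g₀₀, ϖ g₀₁, ϖ σϖ g₀₂; 0, g₁₁, σϖ g₁₂; 0, 0, g₂₂)`. [cite: Rogawski1990, §3.9 p. 32] -/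
theorem torusElt_conj_eq_of_cornerCriterion {ϖ : K} (hϖ : ϖ ≠ 0)
    {d : GL (Fin 3) K} (hd : (d : Matrix (Fin 3) (Fin 3) K) = Matrix.diagonal ![ϖ, 1, (σ ϖ)⁻¹])
    (hd' : ((d⁻¹ : GL (Fin 3) K) : Matrix (Fin 3) (Fin 3) K) = Matrix.diagonal ![ϖ⁻¹, 1, σ ϖ])
    {g : Matrix (Fin 3) (Fin 3) K} (h10 : g 1 0 = 0) (h20 : g 2 0 = 0) (h21 : g 2 1 = 0) :
    (d : Matrix (Fin 3) (Fin 3) K) * g * ((d⁻¹ : GL (Fin 3) K) : Matrix (Fin 3) (Fin 3) K) =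
      !![g 0 0, ϖ * g 0 1, ϖ * σ ϖ * g 0 2; 0, g 1 1, σ ϖ * g 1 2; 0, 0, g 2 2] := by
  have hσϖ : σ ϖ ≠ 0 := (map_ne_zero σ).2 hϖ
  have hd'' : ((d⁻¹ : GL (Fin 3) K) : Matrix (Fin 3) (Fin 3) K) = Matrix.diagonal ![ϖ⁻¹, (1 : K)⁻¹, ((σ ϖ)⁻¹)⁻¹] := by
    rw [hd', inv_one, inv_inv]
  ext i j
  rw [diagonal_conj_apply hd hd'' g i j]
  fin_cases i <;> fin_cases j <;> simp [h10, h20, h21] <;> field_simp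

/-- **`d(ϖ)`-conjugation improves integrality on the centraliser of `n(t)`**: if `g` is integral with `g₁₀ = g₂₀ = g₂₁ = 0`, `|ϖ| ≤ 1` and `|σϖ| ≤ 1`, then
`d(ϖ) g d(ϖ)⁻¹` is integral (its entries are `g₀₀, ϖ g₀₁, ϖ σϖ g₀₂, 0, g₁₁, σϖ g₁₂, 0, 0, g₂₂`). [cite: Rogawski1990, §3.9 p. 32] -/
theorem isIntMatrix_torusElt_conj_of_cornerCriterion {ϖ : K} (hϖ : ϖ ≠ 0) (hvϖ : Valued.v ϖ ≤ 1) (hvσϖ : Valued.v (σ ϖ) ≤ 1)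
    {d : GL (Fin 3) K} (hd : (d : Matrix (Fin 3) (Fin 3) K) = Matrix.diagonal ![ϖ, 1, (σ ϖ)⁻¹])
    (hd' : ((d⁻¹ : GL (Fin 3) K) : Matrix (Fin 3) (Fin 3) K) = Matrix.diagonal ![ϖ⁻¹, 1, σ ϖ])
    {g : Matrix (Fin 3) (Fin 3) K} (hg : IsIntMatrix g) (h10 : g 1 0 = 0) (h20 : g 2 0 = 0) (h21 : g 2 1 = 0) :
    IsIntMatrix ((d : Matrix (Fin 3) (Fin 3) K) * g * ((d⁻¹ : GL (Fin 3) K) : Matrix (Fin 3) (Fin 3) K)) := by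
  rw [torusElt_conj_eq_of_cornerCriterion σ hϖ hd hd' h10 h20 h21]
  have hmul : ∀ {x y : K}, Valued.v x ≤ 1 → Valued.v y ≤ 1 → Valued.v (x * y) ≤ 1 := fun hx hy => by
    rw [map_mul]; exact mul_le_one' hx hy
  intro i j
  fin_cases i <;> fin_cases j
  · exact hg 0 0
  · exact hmul hvϖ (hg 0 1)
  · exact hmul (hmul hvϖ hvσϖ) (hg 0 2)
  · simp
  · exact hg 1 1
  · exact hmul hvσϖ (hg 1 2)
  · simp
  · simp
  · exact hg 2 2

end ValuedField

end Literature.NumberTheory.Automorphic.UnitaryGroup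

/-! ## §2–§3 The CM carrier: covering by level shells (Iwasawa) and the measure bound -/

namespace Literature.NumberTheory.Rogawski1990

open Literature.NumberTheory.Automorphic Literature.NumberTheory.Automorphic.UnitaryGroup Literature.NumberTheory.GaloisRepresentations
open Literature.NumberTheory.Automorphic.UnitaryLatticeTree Literature.NumberTheory.Automorphic.HermitianLattice Literature.MeasureTheory.Group

set_option maxHeartbeats 3200000 in
/-- **RANGA RAO AT THE TRANSVECTION CLASSES OF `U(Φ₃)(L⁺_v)` — FINITENESS OF ORBIT-PREIMAGES OF COMPACTA.**  At a non-split place `v` of `L⁺` (`w ∣ v` fixed by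
complex conjugation), for `u ∈ G = U(Φ₃)(L⁺_v)` whose one-place matrix is the corner transvection `n(t₀) = 1 + t₀E₀₂` (`t₀ ≠ 0`), EVERY `G`-invariant measure `μ` on
`G ⧸ C(u)` finite on compacta gives finite mass to `{y C(u) ∣ y u y⁻¹ ∈ C}` for every compact `C ⊆ G`.  Proof: §2 covering `⊆ ⋃_{m ≥ 0} π(K a^m) ∪ ⋃_{n ≤ n_C} π(K g_n)`
from `G = K·B` (★ Iwasawa) and the entry bound on `K C K`; §3 ★ `measure_iUnion_image_mk_mul_zpow_lt_top` with `a = ψ⁻¹ d(ϖ)` (normalises `C(u)`, improves `K`-integrality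
on it strictly) and ★ `measure_image_mk_mul_singleton_lt_top` for the finitely many `g_n`. [cite: Rao1972, Theorem p. 505] [cite: Rogawski1990, §3.9 p. 32; §4.9 p. 54; §8.1 p. 112]
[cite: HarishChandra1999AdmissibleDistributions, §3.1 p. 17] [cite: BruhatTits1972, (4.4.3)] -/
theorem UnitaryGroup.measure_preimage_descConj_lt_top_of_coe_eq_cornerUnipotent
    (L : Type) [Field L] [NumberField L] [IsCMField L] (v : HeightOneSpectrum (𝓞 ↥(maximalRealSubfield L)))
    (w : PlacesOver L v) (hw : IsCMField.complexConj L • w.1 = w.1)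
    [MeasurableSpace ((cmDatum L 3 (Matrix.of fun i j : Fin 3 => if i.val + j.val + 1 = 3 then (1 : L) else 0)).Local v)]
    [BorelSpace ((cmDatum L 3 (Matrix.of fun i j : Fin 3 => if i.val + j.val + 1 = 3 then (1 : L) else 0)).Local v)]
    [∀ γ : ((cmDatum L 3 (Matrix.of fun i j : Fin 3 => if i.val + j.val + 1 = 3 then (1 : L) else 0)).Local v),
      MeasurableSpace (((cmDatum L 3 (Matrix.of fun i j : Fin 3 => if i.val + j.val + 1 = 3 then (1 : L) else 0)).Local v) ⧸
        Subgroup.centralizer ({γ} : Set ((cmDatum L 3 (Matrix.of fun i j : Fin 3 => if i.val + j.val + 1 = 3 then (1 : L) else 0)).Local v)))]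
    [∀ γ : ((cmDatum L 3 (Matrix.of fun i j : Fin 3 => if i.val + j.val + 1 = 3 then (1 : L) else 0)).Local v),
      BorelSpace (((cmDatum L 3 (Matrix.of fun i j : Fin 3 => if i.val + j.val + 1 = 3 then (1 : L) else 0)).Local v) ⧸
        Subgroup.centralizer ({γ} : Set ((cmDatum L 3 (Matrix.of fun i j : Fin 3 => if i.val + j.val + 1 = 3 then (1 : L) else 0)).Local v)))]
    (u : (cmDatum L 3 (Matrix.of fun i j : Fin 3 => if i.val + j.val + 1 = 3 then (1 : L) else 0)).Local v) {t₀ : w.1.adicCompletion L} (ht₀ : t₀ ≠ 0)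
    (hu : (((localNonsplitEquiv (IsCMField.complexConj L) (Matrix.of fun i j : Fin 3 => if i.val + j.val + 1 = 3 then (1 : L) else 0)
        (IsCMField.complexConj_ne_one L) w hw u :
          ↥(unitaryGroupOfForm (galAdicCompletionMap (L := L) (IsCMField.complexConj L) hw)
            (placeForm (Matrix.of fun i j : Fin 3 => if i.val + j.val + 1 = 3 then (1 : L) else 0) w.1))) : GL (Fin 3) (w.1.adicCompletion L)) :
        Matrix (Fin 3) (Fin 3) (w.1.adicCompletion L)) = !![1, 0, t₀; 0, 1, 0; 0, 0, 1])
    (μ : Measure (((cmDatum L 3 (Matrix.of fun i j : Fin 3 => if i.val + j.val + 1 = 3 then (1 : L) else 0)).Local v) ⧸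
      Subgroup.centralizer ({u} : Set ((cmDatum L 3 (Matrix.of fun i j : Fin 3 => if i.val + j.val + 1 = 3 then (1 : L) else 0)).Local v))))
    [SMulInvariantMeasure ((cmDatum L 3 (Matrix.of fun i j : Fin 3 => if i.val + j.val + 1 = 3 then (1 : L) else 0)).Local v) _ μ] [IsFiniteMeasureOnCompacts μ]
    {C : Set ((cmDatum L 3 (Matrix.of fun i j : Fin 3 => if i.val + j.val + 1 = 3 then (1 : L) else 0)).Local v)} (hC : IsCompact C) :
    μ ((descConj u (Subgroup.centralizer ({u} : Set ((cmDatum L 3 (Matrix.of fun i j : Fin 3 => if i.val + j.val + 1 = 3 then (1 : L) else 0)).Local v)))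
      (fun _ hg => Subgroup.mem_centralizer_singleton_iff.1 hg) id) ⁻¹' C) < ⊤ := by
  classical
  -- ## 0. The frame `ψ = e` (the frame of `Φ₃` is the identity) and its dictionary (★ `UnipotentLevelPiecesFrameCM`)
  have hT : placeForm (Matrix.of fun i j : Fin 3 => if i.val + j.val + 1 = 3 then (1 : L) else 0) w.1 =
      formCongr (galAdicCompletionMap (L := L) (IsCMField.complexConj L) hw) (1 : GL (Fin 3) (w.1.adicCompletion L))
        ((StdForm.antidiagonal 3).over (w.1.adicCompletion L)) := by
    rw [placeForm_antidiagOne]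
    simp [formCongr, Matrix.map_one]
  have hTint : (1 : GL (Fin 3) (w.1.adicCompletion L)) ∈ glInt 3 (w.1.adicCompletion L) := Subgroup.one_mem _
  obtain ⟨ψ, hψ⟩ : ∃ ψ : (cmDatum L 3 (Matrix.of fun i j : Fin 3 => if i.val + j.val + 1 = 3 then (1 : L) else 0)).Local v → GL (Fin 3) (w.1.adicCompletion L),
      ∀ y, ψ y = 1 * ((localNonsplitEquiv (IsCMField.complexConj L) (Matrix.of fun i j : Fin 3 => if i.val + j.val + 1 = 3 then (1 : L) else 0)
        (IsCMField.complexConj_ne_one L) w hw y :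
          ↥(unitaryGroupOfForm (galAdicCompletionMap (L := L) (IsCMField.complexConj L) hw)
            (placeForm (Matrix.of fun i j : Fin 3 => if i.val + j.val + 1 = 3 then (1 : L) else 0) w.1))) : GL (Fin 3) (w.1.adicCompletion L)) * 1⁻¹ :=
    ⟨_, fun _ => rfl⟩
  have hψU : ∀ y, ψ y ∈ unitaryGroupOfForm (galAdicCompletionMap (L := L) (IsCMField.complexConj L) hw) ((StdForm.antidiagonal 3).over (w.1.adicCompletion L)) :=
    fun y => by rw [hψ]; exact conj_localNonsplitEquiv_mem L _ v w hw hT y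
  have hψmul : ∀ y y', ψ (y * y') = ψ y * ψ y' := fun y y' => by simp only [hψ]; exact conj_localNonsplitEquiv_mul L _ v w hw y y'
  have hψinv : ∀ y, ψ y⁻¹ = (ψ y)⁻¹ := fun y => by simp only [hψ]; exact conj_localNonsplitEquiv_inv L _ v w hw y
  have hψsurj : ∀ g ∈ unitaryGroupOfForm (galAdicCompletionMap (L := L) (IsCMField.complexConj L) hw) ((StdForm.antidiagonal 3).over (w.1.adicCompletion L)),
      ∃ y, ψ y = g := fun g hg => by simp only [hψ]; exact exists_conj_localNonsplitEquiv_eq L _ v w hw hT hg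
  have hψK : ∀ y, y ∈ cmLocalIntegralLevel L 3 (Matrix.of fun i j : Fin 3 => if i.val + j.val + 1 = 3 then (1 : L) else 0) v ↔
      IsIntMatrix ((ψ y : GL (Fin 3) (w.1.adicCompletion L)) : Matrix (Fin 3) (Fin 3) (w.1.adicCompletion L)) :=
    fun y => by rw [hψ]; exact mem_cmLocalIntegralLevel_iff_isIntMatrix_conj L _ v w hw hT hTint y
  have hψcont : ∀ a b, Continuous fun y => ((ψ y : GL (Fin 3) (w.1.adicCompletion L)) : Matrix (Fin 3) (Fin 3) (w.1.adicCompletion L)) a b := fun a b => by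
    simp only [hψ]; exact continuous_conj_localNonsplitEquiv_apply L _ v w hw a b
  have hψinj : ∀ y y', ψ y = ψ y' → y = y' := fun y y' h => by
    rw [hψ, hψ] at h; exact conj_localNonsplitEquiv_injective L _ v w hw h
  have hψentry : ∀ (y : (cmDatum L 3 (Matrix.of fun i j : Fin 3 => if i.val + j.val + 1 = 3 then (1 : L) else 0)).Local v) (a b : Fin 3),
      ((ψ y : GL (Fin 3) (w.1.adicCompletion L)) : Matrix (Fin 3) (Fin 3) (w.1.adicCompletion L)) a b =
        (((y.val : GL (Fin 3) (UnitaryGroup.LocalRing L v)) : Matrix (Fin 3) (Fin 3) (UnitaryGroup.LocalRing L v)) a b) w := by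
    intro y a b
    rw [hψ, one_mul, inv_one, mul_one, coe_coe_localNonsplitEquiv_apply]
    rfl
  have hψu : ((ψ u : GL (Fin 3) (w.1.adicCompletion L)) : Matrix (Fin 3) (Fin 3) (w.1.adicCompletion L)) = !![1, 0, t₀; 0, 1, 0; 0, 0, 1] := by
    rw [hψ, one_mul, inv_one, mul_one]; exact hu
  -- the local field data: `σ_w` an involution preserving the valuation, `t₀` skew, a uniformiser `ϖ`
  have hcc : IsCMField.complexConj L * IsCMField.complexConj L = 1 := AlgEquiv.ext fun y => IsCMField.complexConj_apply_apply L y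
  have hσσ : ∀ x : w.1.adicCompletion L, galAdicCompletionMap (L := L) (IsCMField.complexConj L) hw (galAdicCompletionMap (L := L) (IsCMField.complexConj L) hw x) = x :=
    fun x => Literature.NumberTheory.Automorphic.Liu2021.galAdicCompletionMap_galAdicCompletionMap_self _ L (IsCMField.complexConj L) hcc hw x
  have hvσ : ∀ x : w.1.adicCompletion L, Valued.v (galAdicCompletionMap (L := L) (IsCMField.complexConj L) hw x) = Valued.v x :=
    fun x => valued_galAdicCompletionMap (L := L) (IsCMField.complexConj L) hw x
  have hσt₀ : galAdicCompletionMap (L := L) (IsCMField.complexConj L) hw t₀ + t₀ = 0 :=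
    (mem_unitaryGroupOfForm_iff_of_coe_eq_cornerUnipotent _ hψu).1 (hψU u)
  obtain ⟨πL, hπL⟩ := w.1.valuation_exists_uniformizer L
  obtain ⟨ϖ, hϖdef⟩ : ∃ ϖ : w.1.adicCompletion L, ϖ = (πL : w.1.adicCompletion L) := ⟨_, rfl⟩
  have hvϖ : Valued.v ϖ = WithZero.exp (-1 : ℤ) := by rw [hϖdef, HeightOneSpectrum.valuedAdicCompletion_eq_valuation', hπL]
  have hϖ0 : ϖ ≠ 0 := fun h => by rw [h, map_zero] at hvϖ; exact WithZero.exp_ne_zero hvϖ.symm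
  have hvϖle : Valued.v ϖ ≤ 1 := by rw [hvϖ, ← WithZero.exp_zero]; exact WithZero.exp_le_exp.2 (by norm_num)
  have hvσϖle : Valued.v (galAdicCompletionMap (L := L) (IsCMField.complexConj L) hw ϖ) ≤ 1 := by rw [hvσ]; exact hvϖle
  -- the contracting element `a = ψ⁻¹ d(ϖ)`, `d(ϖ) = diag(ϖ, 1, (σϖ)⁻¹)`
  obtain ⟨dϖ, hdϖ, hdϖ'⟩ := exists_units_coe_eq_torusElt (galAdicCompletionMap (L := L) (IsCMField.complexConj L) hw) hϖ0
  have hdϖU := torusElt_mem_unitaryGroupOfForm (galAdicCompletionMap (L := L) (IsCMField.complexConj L) hw) hϖ0 (hσσ ϖ) hdϖ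
  obtain ⟨a, ha⟩ := hψsurj dϖ hdϖU
  have haconj : ∀ y, ((ψ (a * y * a⁻¹) : GL (Fin 3) (w.1.adicCompletion L)) : Matrix (Fin 3) (Fin 3) (w.1.adicCompletion L)) =
      (dϖ : Matrix (Fin 3) (Fin 3) (w.1.adicCompletion L)) * ((ψ y : GL (Fin 3) (w.1.adicCompletion L)) : Matrix (Fin 3) (Fin 3) (w.1.adicCompletion L)) *
        ((dϖ⁻¹ : GL (Fin 3) (w.1.adicCompletion L)) : Matrix (Fin 3) (Fin 3) (w.1.adicCompletion L)) := by
    intro y; rw [hψmul, hψmul, hψinv, ha, Units.val_mul, Units.val_mul]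
  -- ## 1. The centraliser `C(u)` through `ψ`: the commutation criterion with `n(t₀)`
  have hcent : ∀ y, y ∈ Subgroup.centralizer ({u} : Set ((cmDatum L 3 (Matrix.of fun i j : Fin 3 => if i.val + j.val + 1 = 3 then (1 : L) else 0)).Local v)) ↔
      (((ψ y : GL (Fin 3) (w.1.adicCompletion L)) : Matrix (Fin 3) (Fin 3) (w.1.adicCompletion L)) 1 0 = 0 ∧
        ((ψ y : GL (Fin 3) (w.1.adicCompletion L)) : Matrix (Fin 3) (Fin 3) (w.1.adicCompletion L)) 2 0 = 0 ∧
        ((ψ y : GL (Fin 3) (w.1.adicCompletion L)) : Matrix (Fin 3) (Fin 3) (w.1.adicCompletion L)) 2 1 = 0 ∧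
        ((ψ y : GL (Fin 3) (w.1.adicCompletion L)) : Matrix (Fin 3) (Fin 3) (w.1.adicCompletion L)) 0 0 =
          ((ψ y : GL (Fin 3) (w.1.adicCompletion L)) : Matrix (Fin 3) (Fin 3) (w.1.adicCompletion L)) 2 2) := by
    intro y
    rw [Subgroup.mem_centralizer_singleton_iff, ← mul_cornerUnipotent_eq_cornerUnipotent_mul_iff ht₀, ← hψu, ← Units.val_mul, ← Units.val_mul, ← hψmul, ← hψmul]
    constructor
    · intro h; rw [h]
    · intro h; exact hψinj _ _ (Units.ext h)
  -- `a` normalises `C(u)`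
  have hdϖ'' : ((dϖ⁻¹ : GL (Fin 3) (w.1.adicCompletion L)) : Matrix (Fin 3) (Fin 3) (w.1.adicCompletion L)) =
      Matrix.diagonal ![ϖ⁻¹, (1 : w.1.adicCompletion L)⁻¹, ((galAdicCompletionMap (L := L) (IsCMField.complexConj L) hw ϖ)⁻¹)⁻¹] := by
    rw [hdϖ', inv_one, inv_inv]
  have hσϖ0 : galAdicCompletionMap (L := L) (IsCMField.complexConj L) hw ϖ ≠ 0 := (map_ne_zero _).2 hϖ0
  have hanorm : ∀ h, h ∈ Subgroup.centralizer ({u} : Set ((cmDatum L 3 (Matrix.of fun i j : Fin 3 => if i.val + j.val + 1 = 3 then (1 : L) else 0)).Local v)) ↔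
      a * h * a⁻¹ ∈ Subgroup.centralizer ({u} : Set ((cmDatum L 3 (Matrix.of fun i j : Fin 3 => if i.val + j.val + 1 = 3 then (1 : L) else 0)).Local v)) := by
    intro h
    rw [hcent, hcent, haconj]
    exact cornerCriterion_conj_diagonal_iff hdϖ hdϖ'' hϖ0 one_ne_zero (inv_ne_zero hσϖ0) _
  -- `Ad(a)` improves `K`-integrality on `C(u)`
  have haK : ∀ h, h ∈ Subgroup.centralizer ({u} : Set ((cmDatum L 3 (Matrix.of fun i j : Fin 3 => if i.val + j.val + 1 = 3 then (1 : L) else 0)).Local v)) →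
      h ∈ cmLocalIntegralLevel L 3 (Matrix.of fun i j : Fin 3 => if i.val + j.val + 1 = 3 then (1 : L) else 0) v →
      a * h * a⁻¹ ∈ cmLocalIntegralLevel L 3 (Matrix.of fun i j : Fin 3 => if i.val + j.val + 1 = 3 then (1 : L) else 0) v := by
    intro h hh hK
    obtain ⟨h10, h20, h21, -⟩ := (hcent h).1 hh
    rw [hψK, haconj]
    exact isIntMatrix_torusElt_conj_of_cornerCriterion _ hϖ0 hvϖle hvσϖle hdϖ hdϖ' ((hψK h).1 hK) h10 h20 h21
  -- … STRICTLY: the witness `ψ⁻¹ n(s)`, `s = t₀ (ϖ σϖ)^k` skew with `1 < |s| ≤ |ϖ|⁻²`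
  obtain ⟨nt, hnt⟩ : ∃ nt : ℤ, Valued.v t₀ = WithZero.exp nt := by
    have h0 : Valued.v t₀ ≠ 0 := (Valuation.ne_zero_iff _).2 ht₀
    obtain ⟨x, hx⟩ := WithZero.ne_zero_iff_exists.1 h0
    exact ⟨Multiplicative.toAdd x, by rw [← hx]; rfl⟩
  obtain ⟨k, m, hm12, hkm⟩ : ∃ k m : ℤ, (m = 1 ∨ m = 2) ∧ nt = m + 2 * k :=
    ⟨(nt - 1) / 2, nt - 2 * ((nt - 1) / 2), by omega, by ring⟩
  obtain ⟨s, hsdef⟩ : ∃ s : w.1.adicCompletion L, s = t₀ * (ϖ * galAdicCompletionMap (L := L) (IsCMField.complexConj L) hw ϖ) ^ k := ⟨_, rfl⟩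
  have hvN : Valued.v (ϖ * galAdicCompletionMap (L := L) (IsCMField.complexConj L) hw ϖ) = WithZero.exp (-2 : ℤ) := by
    rw [map_mul, hvσ, hvϖ, ← WithZero.exp_add]; norm_num
  have hvs : Valued.v s = WithZero.exp m := by
    have e1 : Valued.v ((ϖ * galAdicCompletionMap (L := L) (IsCMField.complexConj L) hw ϖ) ^ k) = WithZero.exp (-2 * k) := by
      rw [map_zpow₀, hvN, ← WithZero.exp_zsmul, smul_eq_mul]; congr 1; ring
    rw [hsdef, map_mul, hnt, e1, ← WithZero.exp_add, hkm]; congr 1; ring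
  have hσs : galAdicCompletionMap (L := L) (IsCMField.complexConj L) hw s + s = 0 := by
    have hσt : galAdicCompletionMap (L := L) (IsCMField.complexConj L) hw t₀ = -t₀ := eq_neg_of_add_eq_zero_left hσt₀
    rw [hsdef, map_mul, map_zpow₀, map_mul, hσσ, hσt, mul_comm (galAdicCompletionMap (L := L) (IsCMField.complexConj L) hw ϖ) ϖ]
    ring
  have hvs_gt : ¬ Valued.v s ≤ 1 := by
    rw [hvs, ← WithZero.exp_zero, WithZero.exp_le_exp]; omega
  have hvNs : Valued.v (ϖ * galAdicCompletionMap (L := L) (IsCMField.complexConj L) hw ϖ * s) ≤ 1 := by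
    rw [map_mul, hvN, hvs, ← WithZero.exp_add, ← WithZero.exp_zero, WithZero.exp_le_exp]; omega
  obtain ⟨ns, hns⟩ := exists_units_coe_eq_cornerUnipotent' s
  have hnsU : ns ∈ unitaryGroupOfForm (galAdicCompletionMap (L := L) (IsCMField.complexConj L) hw) ((StdForm.antidiagonal 3).over (w.1.adicCompletion L)) :=
    (mem_unitaryGroupOfForm_iff_of_coe_eq_cornerUnipotent _ hns).2 hσs
  obtain ⟨ys, hys⟩ := hψsurj ns hnsU
  have hstrict : ∃ h, h ∈ Subgroup.centralizer ({u} : Set ((cmDatum L 3 (Matrix.of fun i j : Fin 3 => if i.val + j.val + 1 = 3 then (1 : L) else 0)).Local v)) ∧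
      h ∉ cmLocalIntegralLevel L 3 (Matrix.of fun i j : Fin 3 => if i.val + j.val + 1 = 3 then (1 : L) else 0) v ∧
      a * h * a⁻¹ ∈ cmLocalIntegralLevel L 3 (Matrix.of fun i j : Fin 3 => if i.val + j.val + 1 = 3 then (1 : L) else 0) v := by
    refine ⟨ys, ?_, ?_, ?_⟩
    · rw [hcent, hys, hns]
      refine ⟨?_, ?_, ?_, ?_⟩ <;> simp [Matrix.cons_val_one]
    · rw [hψK, hys, hns]
      intro hint
      have h02 := hint 0 2
      simp only [Matrix.of_apply, Matrix.cons_val', Matrix.cons_val_zero, Matrix.cons_val_two, Matrix.tail_cons,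
        Matrix.head_cons, Matrix.empty_val', Matrix.cons_val_fin_one] at h02
      exact hvs_gt h02
    · rw [hψK, haconj, hys, ← Units.val_mul, ← Units.val_mul,
        coe_torusElt_conj_cornerUnipotent (galAdicCompletionMap (L := L) (IsCMField.complexConj L) hw) hϖ0 hdϖ hdϖ' hns]
      obtain ⟨nn, hnn⟩ := exists_units_coe_eq_cornerUnipotent' (ϖ * galAdicCompletionMap (L := L) (IsCMField.complexConj L) hw ϖ * s)
      rw [← hnn]
      exact isIntMatrix_cornerUnipotent hvNs hnn
  -- ## 2. Haar measures: `ν` on `G` (right invariant: `U(Φ₃)(L⁺_v)` is unimodular) and `ρ` on the closed subgroup `C(u)`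
  haveI hHcl : IsClosed ((Subgroup.centralizer ({u} : Set ((cmDatum L 3 (Matrix.of fun i j : Fin 3 => if i.val + j.val + 1 = 3 then (1 : L) else 0)).Local v)) : Subgroup ((cmDatum L 3 (Matrix.of fun i j : Fin 3 => if i.val + j.val + 1 = 3 then (1 : L) else 0)).Local v)) : Set ((cmDatum L 3 (Matrix.of fun i j : Fin 3 => if i.val + j.val + 1 = 3 then (1 : L) else 0)).Local v)) := isClosed_coe_centralizer_singleton u
  haveI : LocallyCompactSpace ↥(Subgroup.centralizer ({u} : Set ((cmDatum L 3 (Matrix.of fun i j : Fin 3 => if i.val + j.val + 1 = 3 then (1 : L) else 0)).Local v))) := hHcl.isClosedEmbedding_subtypeVal.locallyCompactSpace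
  obtain ⟨ρ, hρ⟩ : ∃ ρ : Measure ↥(Subgroup.centralizer ({u} : Set ((cmDatum L 3 (Matrix.of fun i j : Fin 3 => if i.val + j.val + 1 = 3 then (1 : L) else 0)).Local v))), ρ = Measure.haar := ⟨_, rfl⟩
  haveI : ρ.IsHaarMeasure := by rw [hρ]; infer_instance
  obtain ⟨ν, hν⟩ : ∃ ν : Measure ((cmDatum L 3 (Matrix.of fun i j : Fin 3 => if i.val + j.val + 1 = 3 then (1 : L) else 0)).Local v), ν = Measure.haar := ⟨_, rfl⟩
  haveI : ν.IsHaarMeasure := by rw [hν]; infer_instance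
  have hiso : ∃ x : Fin 3 → L, x ≠ 0 ∧ dotProduct (fun i => IsCMField.complexConj L (x i)) ((Matrix.of fun i j : Fin 3 => if i.val + j.val + 1 = 3 then (1 : L) else 0).mulVec x) = 0 :=
    ⟨Pi.single 0 1, by simp, by simp [Matrix.mulVec, dotProduct, Fin.sum_univ_three, Pi.single_apply]⟩
  haveI : ν.IsMulRightInvariant := isMulRightInvariant_cmDatum_local_of_adelic L (Matrix.of fun i j : Fin 3 => if i.val + j.val + 1 = 3 then (1 : L) else 0) v
    (modularCharacter_cmDatum_eq_one_of_isotropic L three_ne_zero (Matrix.of fun i j : Fin 3 => if i.val + j.val + 1 = 3 then (1 : L) else 0) (antidiagOne_isHermitian L 3) (isUnit_antidiagOne_det L 3).ne_zero hiso) ν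
  -- ## 3. The covering of the orbit-preimage of `C` by level shells
  obtain ⟨hKc, hKo⟩ := isCompact_isOpen_cmLocalIntegralLevel L 3 (Matrix.of fun i j : Fin 3 => if i.val + j.val + 1 = 3 then (1 : L) else 0) v
  have hC₁ : IsCompact ((cmLocalIntegralLevel L 3 (Matrix.of fun i j : Fin 3 => if i.val + j.val + 1 = 3 then (1 : L) else 0) v : Set ((cmDatum L 3 (Matrix.of fun i j : Fin 3 => if i.val + j.val + 1 = 3 then (1 : L) else 0)).Local v)) * C * (cmLocalIntegralLevel L 3 (Matrix.of fun i j : Fin 3 => if i.val + j.val + 1 = 3 then (1 : L) else 0) v : Set ((cmDatum L 3 (Matrix.of fun i j : Fin 3 => if i.val + j.val + 1 = 3 then (1 : L) else 0)).Local v))) := (hKc.mul hC).mul hKc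
  have hball : ∀ mm : ℤ, IsOpen {x : (w.1.adicCompletion L) | Valued.v x ≤ WithZero.exp mm} := fun mm => (isClopen_setOf_valued_le L w.1 WithZero.exp_ne_zero).isOpen
  have hexp_of_ne : ∀ {x : (w.1.adicCompletion L)}, x ≠ 0 → ∃ n : ℤ, Valued.v x = WithZero.exp n := fun {x} hx => by
    have h0 : Valued.v x ≠ 0 := (Valuation.ne_zero_iff _).2 hx
    obtain ⟨e, he⟩ := WithZero.ne_zero_iff_exists.1 h0
    exact ⟨Multiplicative.toAdd e, by rw [← he]; rfl⟩
  obtain ⟨Mb, hMb⟩ : ∃ Mb : ℤ, ∀ g ∈ (cmLocalIntegralLevel L 3 (Matrix.of fun i j : Fin 3 => if i.val + j.val + 1 = 3 then (1 : L) else 0) v : Set ((cmDatum L 3 (Matrix.of fun i j : Fin 3 => if i.val + j.val + 1 = 3 then (1 : L) else 0)).Local v)) * C * (cmLocalIntegralLevel L 3 (Matrix.of fun i j : Fin 3 => if i.val + j.val + 1 = 3 then (1 : L) else 0) v : Set ((cmDatum L 3 (Matrix.of fun i j : Fin 3 => if i.val + j.val + 1 = 3 then (1 : L) else 0)).Lo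cal v)),
      Valued.v (((ψ g : GL (Fin 3) (w.1.adicCompletion L)) : Matrix (Fin 3) (Fin 3) (w.1.adicCompletion L)) 0 2) ≤ WithZero.exp Mb := by
    obtain ⟨U, hU⟩ : ∃ U : ℕ → Set ((cmDatum L 3 (Matrix.of fun i j : Fin 3 => if i.val + j.val + 1 = 3 then (1 : L) else 0)).Local v), ∀ mm, U mm = (fun y => ((ψ y : GL (Fin 3) (w.1.adicCompletion L)) : Matrix (Fin 3) (Fin 3) (w.1.adicCompletion L)) 0 2) ⁻¹'
        {x : (w.1.adicCompletion L) | Valued.v x ≤ WithZero.exp (mm : ℤ)} := ⟨_, fun _ => rfl⟩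
    have hUo : ∀ mm, IsOpen (U mm) := fun mm => by rw [hU]; exact (hball mm).preimage (hψcont 0 2)
    have hcov : (cmLocalIntegralLevel L 3 (Matrix.of fun i j : Fin 3 => if i.val + j.val + 1 = 3 then (1 : L) else 0) v : Set ((cmDatum L 3 (Matrix.of fun i j : Fin 3 => if i.val + j.val + 1 = 3 then (1 : L) else 0)).Local v)) * C * (cmLocalIntegralLevel L 3 (Matrix.of fun i j : Fin 3 => if i.val + j.val + 1 = 3 then (1 : L) else 0) v : Set ((cmDatum L 3 (Matrix.of fun i j : Fin 3 => if i.val + j.val + 1 = 3 then (1 : L) else 0)).Local v)) ⊆ ⋃ mm, U mm := by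
      intro g _
      rcases eq_or_ne (((ψ g : GL (Fin 3) (w.1.adicCompletion L)) : Matrix (Fin 3) (Fin 3) (w.1.adicCompletion L)) 0 2) 0 with h0 | h0
      · exact Set.mem_iUnion.2 ⟨0, by rw [hU]; simp [h0]⟩
      · obtain ⟨n, hn⟩ := hexp_of_ne h0
        refine Set.mem_iUnion.2 ⟨n.toNat, ?_⟩
        rw [hU, Set.mem_preimage, Set.mem_setOf_eq, hn]
        exact WithZero.exp_le_exp.2 (Int.self_le_toNat n)
    obtain ⟨t, ht⟩ := hC₁.elim_finite_subcover U hUo hcov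
    refine ⟨((t.sup id : ℕ) : ℤ), fun g hg => ?_⟩
    obtain ⟨mm, hmm, hgm⟩ := Set.mem_iUnion₂.1 (ht hg)
    rw [hU] at hgm
    exact (le_of_eq_of_le rfl hgm).trans (WithZero.exp_le_exp.2 (by exact_mod_cast Finset.le_sup (f := id) hmm))
  -- the auxiliary shells `g_n`, `ψ g_n = d(ϖ⁻¹ ^ n)`, for the finitely many positive levels
  have hzpow : ∀ n : ℕ, (ϖ⁻¹) ^ n ≠ 0 := fun n => pow_ne_zero _ (inv_ne_zero hϖ0)
  have hgn : ∀ n : ℕ, ∃ (dz : GL (Fin 3) (w.1.adicCompletion L)) (y : ((cmDatum L 3 (Matrix.of fun i j : Fin 3 => if i.val + j.val + 1 = 3 then (1 : L) else 0)).Local v)), (dz : Matrix (Fin 3) (Fin 3) (w.1.adicCompletion L)) = Matrix.diagonal ![ϖ⁻¹ ^ n, 1, ((galAdicCompletionMap (L := L) (IsCMField.complexConj L) hw) (ϖ⁻¹ ^ n))⁻¹] ∧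
      ((dz⁻¹ : GL (Fin 3) (w.1.adicCompletion L)) : Matrix (Fin 3) (Fin 3) (w.1.adicCompletion L)) = Matrix.diagonal ![(ϖ⁻¹ ^ n)⁻¹, 1, (galAdicCompletionMap (L := L) (IsCMField.complexConj L) hw) (ϖ⁻¹ ^ n)] ∧ ψ y = dz := by
    intro n
    obtain ⟨dz, hdz, hdz'⟩ := exists_units_coe_eq_torusElt (galAdicCompletionMap (L := L) (IsCMField.complexConj L) hw) (hzpow n)
    obtain ⟨y, hy⟩ := hψsurj dz (torusElt_mem_unitaryGroupOfForm (galAdicCompletionMap (L := L) (IsCMField.complexConj L) hw) (hzpow n) (hσσ _) hdz)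
    exact ⟨dz, y, hdz, hdz', hy⟩
  choose dz g hdz hdz' hg using hgn
  -- `ψ (a ^ m) = diag(ϖ^m, 1, (σϖ)⁻¹^m)`
  have hψone : ψ 1 = 1 := by
    have h := hψmul 1 1
    rw [one_mul] at h
    exact left_eq_mul.1 h |> id |> fun e => by simpa using e
  have hapow : ∀ mm : ℕ, ((ψ (a ^ mm) : GL (Fin 3) (w.1.adicCompletion L)) : Matrix (Fin 3) (Fin 3) (w.1.adicCompletion L)) = Matrix.diagonal ![ϖ ^ mm, 1, ((galAdicCompletionMap (L := L) (IsCMField.complexConj L) hw) ϖ)⁻¹ ^ mm] := by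
    intro mm
    induction mm with
    | zero =>
      rw [pow_zero, hψone, Units.val_one, pow_zero, pow_zero]
      ext i j; fin_cases i <;> fin_cases j <;> simp [Matrix.diagonal]
    | succ n ih =>
      rw [pow_succ, hψmul, Units.val_mul, ih, ha, hdϖ, Matrix.diagonal_mul_diagonal]
      congr 1; funext i; fin_cases i <;> simp [pow_succ]
  -- the covering
  have hcover : (descConj u (Subgroup.centralizer ({u} : Set ((cmDatum L 3 (Matrix.of fun i j : Fin 3 => if i.val + j.val + 1 = 3 then (1 : L) else 0)).Local v))) (fun _ hg => Subgroup.mem_centralizer_singleton_iff.1 hg) id) ⁻¹' C ⊆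
      (⋃ mm : ℕ, (QuotientGroup.mk : ((cmDatum L 3 (Matrix.of fun i j : Fin 3 => if i.val + j.val + 1 = 3 then (1 : L) else 0)).Local v) → ((cmDatum L 3 (Matrix.of fun i j : Fin 3 => if i.val + j.val + 1 = 3 then (1 : L) else 0)).Local v) ⧸ Subgroup.centralizer ({u} : Set ((cmDatum L 3 (Matrix.of fun i j : Fin 3 => if i.val + j.val + 1 = 3 then (1 : L) else 0)).Local v))) '' ((cmLocalIntegralLevel L 3 (Matrix.of fun i j : Fin 3 => if i.val + j.val + 1 = 3 then (1 : L) else 0) v : Set ((cmDatum L 3 (Matrix.of fun i j : Fin 3 => if i.val + j.val + 1 = 3 then (1 : L) else 0)).Local v)) * {a ^ mm})) ∪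
        ⋃ n ∈ Finset.Icc 1 (Mb - nt).toNat,
          (QuotientGroup.mk : ((cmDatum L 3 (Matrix.of fun i j : Fin 3 => if i.val + j.val + 1 = 3 then (1 : L) else 0)).Local v) → ((cmDatum L 3 (Matrix.of fun i j : Fin 3 => if i.val + j.val + 1 = 3 then (1 : L) else 0)).Local v) ⧸ Subgroup.centralizer ({u} : Set ((cmDatum L 3 (Matrix.of fun i j : Fin 3 => if i.val + j.val + 1 = 3 then (1 : L) else 0)).Local v))) '' ((cmLocalIntegralLevel L 3 (Matrix.of fun i j : Fin 3 => if i.val + j.val + 1 = 3 then (1 : L) else 0) v : Set ((cmDatum L 3 (Matrix.of fun i j : Fin 3 => if i.val + j.val + 1 = 3 then (1 : L) else 0)).Local v)) * {g n}) := by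
    intro x hx
    obtain ⟨y, rfl⟩ := QuotientGroup.mk_surjective x
    rw [Set.mem_preimage, descConj_mk] at hx
    change y * u * y⁻¹ ∈ C at hx
    -- Iwasawa `y = κ b`
    obtain ⟨κ₁, hκK₁, b₁, hyb₁⟩ := exists_mem_cmLocalIntegralLevel_mul_borel L 3 v y
    have hbB := (mem_borelU_iff _).1 b₁.2
    -- re-type `κ`, `b` on the `cmDatum` carrier (the two renderings of `U(Φ₃)(L⁺_v)` agree definitionally, ★ `cmDatum_Local_eq`)
    obtain ⟨κ, hκ⟩ : ∃ κ : ((cmDatum L 3 (Matrix.of fun i j : Fin 3 => if i.val + j.val + 1 = 3 then (1 : L) else 0)).Local v), κ = κ₁ := ⟨_, rfl⟩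
    obtain ⟨b, hb⟩ : ∃ b : ((cmDatum L 3 (Matrix.of fun i j : Fin 3 => if i.val + j.val + 1 = 3 then (1 : L) else 0)).Local v), b = (b₁ : ↥(unitaryGroupOfForm (conjLocal L (IsCMField.complexConj L) v) (cmLocalForm L 3 v))) := ⟨_, rfl⟩
    have hκK : κ ∈ cmLocalIntegralLevel L 3 (Matrix.of fun i j : Fin 3 => if i.val + j.val + 1 = 3 then (1 : L) else 0) v := by rw [hκ]; exact hκK₁
    have hyb : y = κ * b := by rw [hκ, hb]; exact hyb₁
    have hb10 : ((ψ b : GL (Fin 3) (w.1.adicCompletion L)) : Matrix (Fin 3) (Fin 3) (w.1.adicCompletion L)) 1 0 = 0 := by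
      rw [hψentry, hb]; exact (congrFun (hbB (show id (0 : Fin 3) < id (1 : Fin 3) by decide)) w).trans rfl
    have hb20 : ((ψ b : GL (Fin 3) (w.1.adicCompletion L)) : Matrix (Fin 3) (Fin 3) (w.1.adicCompletion L)) 2 0 = 0 := by
      rw [hψentry, hb]; exact (congrFun (hbB (show id (0 : Fin 3) < id (2 : Fin 3) by decide)) w).trans rfl
    have hb21 : ((ψ b : GL (Fin 3) (w.1.adicCompletion L)) : Matrix (Fin 3) (Fin 3) (w.1.adicCompletion L)) 2 1 = 0 := by
      rw [hψentry, hb]; exact (congrFun (hbB (show id (1 : Fin 3) < id (2 : Fin 3) by decide)) w).trans rfl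
    obtain ⟨h2200, h1111⟩ := diag_rel_of_upper_mem_unitaryGroupOfForm (galAdicCompletionMap (L := L) (IsCMField.complexConj L) hw) (hψU b) hb10 hb20 hb21
    have h00ne : ((ψ b : GL (Fin 3) (w.1.adicCompletion L)) : Matrix (Fin 3) (Fin 3) (w.1.adicCompletion L)) 0 0 ≠ 0 := fun h => by
      rw [h, mul_zero] at h2200; exact zero_ne_one h2200
    have h22ne : ((ψ b : GL (Fin 3) (w.1.adicCompletion L)) : Matrix (Fin 3) (Fin 3) (w.1.adicCompletion L)) 2 2 ≠ 0 := fun h => by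
      rw [h, map_zero, zero_mul] at h2200; exact zero_ne_one h2200
    have h11ne : ((ψ b : GL (Fin 3) (w.1.adicCompletion L)) : Matrix (Fin 3) (Fin 3) (w.1.adicCompletion L)) 1 1 ≠ 0 := fun h => by
      rw [h, mul_zero] at h1111; exact zero_ne_one h1111
    obtain ⟨n₀, hn₀⟩ := hexp_of_ne h00ne
    have hv22 : Valued.v (((ψ b : GL (Fin 3) (w.1.adicCompletion L)) : Matrix (Fin 3) (Fin 3) (w.1.adicCompletion L)) 2 2) = WithZero.exp (-n₀) := by
      have h := congrArg Valued.v h2200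
      rw [map_mul, hvσ, map_one, hn₀] at h
      rw [WithZero.exp_neg, ← mul_eq_one_iff_eq_inv₀ WithZero.exp_ne_zero]
      exact h
    have hv11 : Valued.v (((ψ b : GL (Fin 3) (w.1.adicCompletion L)) : Matrix (Fin 3) (Fin 3) (w.1.adicCompletion L)) 1 1) = 1 := by
      obtain ⟨n₁, hn₁⟩ := hexp_of_ne h11ne
      have h := congrArg Valued.v h1111
      rw [map_mul, hvσ, map_one, hn₁, ← WithZero.exp_add, ← WithZero.exp_zero] at h
      have := WithZero.exp_injective h
      rw [hn₁, ← WithZero.exp_zero]; congr 1; omega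
    -- `ψ(b u b⁻¹) = n(t₀ h₀₀ σh₀₀)` lies in `ψ(K C K)`: the level `n₀` is bounded above
    have hbub : ((ψ (b * u * b⁻¹) : GL (Fin 3) (w.1.adicCompletion L)) : Matrix (Fin 3) (Fin 3) (w.1.adicCompletion L)) =
        !![1, 0, t₀ * ((ψ b : GL (Fin 3) (w.1.adicCompletion L)) : Matrix (Fin 3) (Fin 3) (w.1.adicCompletion L)) 0 0 * (galAdicCompletionMap (L := L) (IsCMField.complexConj L) hw) (((ψ b : GL (Fin 3) (w.1.adicCompletion L)) : Matrix (Fin 3) (Fin 3) (w.1.adicCompletion L)) 0 0); 0, 1, 0; 0, 0, 1] := by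
      rw [hψmul, hψmul, hψinv]
      exact coe_conj_cornerUnipotent_of_apply_zero_eq_zero (galAdicCompletionMap (L := L) (IsCMField.complexConj L) hw) hψu (hψU b) hb10 hb20
    have hmemC₁ : b * u * b⁻¹ ∈ (cmLocalIntegralLevel L 3 (Matrix.of fun i j : Fin 3 => if i.val + j.val + 1 = 3 then (1 : L) else 0) v : Set ((cmDatum L 3 (Matrix.of fun i j : Fin 3 => if i.val + j.val + 1 = 3 then (1 : L) else 0)).Local v)) * C * (cmLocalIntegralLevel L 3 (Matrix.of fun i j : Fin 3 => if i.val + j.val + 1 = 3 then (1 : L) else 0) v : Set ((cmDatum L 3 (Matrix.of fun i j : Fin 3 => if i.val + j.val + 1 = 3 then (1 : L) else 0)).Local v)) := by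
      have e : b * u * b⁻¹ = κ⁻¹ * (y * u * y⁻¹) * κ := by rw [hyb]; group
      rw [e]
      exact Set.mul_mem_mul (Set.mul_mem_mul ((cmLocalIntegralLevel L 3 (Matrix.of fun i j : Fin 3 => if i.val + j.val + 1 = 3 then (1 : L) else 0) v).inv_mem hκK) hx) hκK
    have hlev : nt + n₀ + n₀ ≤ Mb := by
      have h := hMb _ hmemC₁
      rw [hbub] at h
      simp only [Matrix.of_apply, Matrix.cons_val', Matrix.cons_val_zero, Matrix.cons_val_two, Matrix.tail_cons, Matrix.head_cons,
        Matrix.empty_val', Matrix.cons_val_fin_one] at h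
      rw [map_mul, map_mul, hvσ, hnt, hn₀, ← WithZero.exp_add, ← WithZero.exp_add, WithZero.exp_le_exp] at h
      exact h
    -- the diagonal part `d`, `ψ d = diag(h₀₀, h₁₁, h₂₂)`, and `n′ = d⁻¹ b ∈ C(u)`
    obtain ⟨dD, hdD, hdD'⟩ := exists_units_coe_eq_diagonal₃ h00ne h11ne h22ne
    have hdDU : dD ∈ unitaryGroupOfForm (galAdicCompletionMap (L := L) (IsCMField.complexConj L) hw) ((StdForm.antidiagonal 3).over (w.1.adicCompletion L)) := by
      refine (diagonal_mem_unitaryGroupOfForm_three_iff (galAdicCompletionMap (L := L) (IsCMField.complexConj L) hw) hdD).2 ⟨?_, h1111, h2200⟩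
      have h := congrArg (galAdicCompletionMap (L := L) (IsCMField.complexConj L) hw) h2200
      rw [map_mul, hσσ, map_one] at h
      rw [mul_comm]; exact h
    obtain ⟨d, hd⟩ := hψsurj dD hdDU
    have hn' : d⁻¹ * b ∈ Subgroup.centralizer ({u} : Set ((cmDatum L 3 (Matrix.of fun i j : Fin 3 => if i.val + j.val + 1 = 3 then (1 : L) else 0)).Local v)) := by
      rw [hcent, hψmul, hψinv, hd, Units.val_mul, hdD']
      refine ⟨?_, ?_, ?_, ?_⟩ <;>
        simp [Matrix.mul_apply, Matrix.diagonal, hb10, hb20, hb21, inv_mul_cancel₀ h00ne, inv_mul_cancel₀ h22ne]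
    -- common tail: a shell element `gg` with `ψ gg = d(z)`, `|z| = |h₀₀|`, carries `y C(u)`
    have key : ∀ (gg : ((cmDatum L 3 (Matrix.of fun i j : Fin 3 => if i.val + j.val + 1 = 3 then (1 : L) else 0)).Local v)) (z : (w.1.adicCompletion L)) (dzz : GL (Fin 3) (w.1.adicCompletion L)), z ≠ 0 →
        (dzz : Matrix (Fin 3) (Fin 3) (w.1.adicCompletion L)) = Matrix.diagonal ![z, 1, ((galAdicCompletionMap (L := L) (IsCMField.complexConj L) hw) z)⁻¹] →
        ((dzz⁻¹ : GL (Fin 3) (w.1.adicCompletion L)) : Matrix (Fin 3) (Fin 3) (w.1.adicCompletion L)) = Matrix.diagonal ![z⁻¹, 1, (galAdicCompletionMap (L := L) (IsCMField.complexConj L) hw) z] →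
        ψ gg = dzz → Valued.v z = WithZero.exp n₀ →
        (QuotientGroup.mk y : ((cmDatum L 3 (Matrix.of fun i j : Fin 3 => if i.val + j.val + 1 = 3 then (1 : L) else 0)).Local v) ⧸ Subgroup.centralizer ({u} : Set ((cmDatum L 3 (Matrix.of fun i j : Fin 3 => if i.val + j.val + 1 = 3 then (1 : L) else 0)).Local v))) ∈
          (QuotientGroup.mk : ((cmDatum L 3 (Matrix.of fun i j : Fin 3 => if i.val + j.val + 1 = 3 then (1 : L) else 0)).Local v) → ((cmDatum L 3 (Matrix.of fun i j : Fin 3 => if i.val + j.val + 1 = 3 then (1 : L) else 0)).Local v) ⧸ Subgroup.centralizer ({u} : Set ((cmDatum L 3 (Matrix.of fun i j : Fin 3 => if i.val + j.val + 1 = 3 then (1 : L) else 0)).Local v))) '' ((cmLocalIntegralLevel L 3 (Matrix.of fun i j : Fin 3 => if i.val + j.val + 1 = 3 then (1 : L) else 0) v : Set ((cmDatum L 3 (Matrix.of fun i j : Fin 3 => if i.val + j.val + 1 = 3 then (1 : L) else 0)).Local v)) * {gg}) := by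
      intro gg z dzz hz hdzz hdzz' hgg hvz
      have hd₀K : d * gg⁻¹ ∈ cmLocalIntegralLevel L 3 (Matrix.of fun i j : Fin 3 => if i.val + j.val + 1 = 3 then (1 : L) else 0) v := by
        rw [hψK, hψmul, hψinv, hd, hgg, Units.val_mul, hdD, hdzz', Matrix.diagonal_mul_diagonal]
        intro i j
        fin_cases i <;> fin_cases j
        · show Valued.v ((![_, _, _] : Fin 3 → (w.1.adicCompletion L)) 0 * (![_, _, _] : Fin 3 → (w.1.adicCompletion L)) 0) ≤ 1
          simp only [Matrix.cons_val_zero]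
          rw [map_mul, map_inv₀, hn₀, hvz, mul_inv_cancel₀ WithZero.exp_ne_zero]
        · simp
        · simp
        · simp
        · show Valued.v ((![_, _, _] : Fin 3 → (w.1.adicCompletion L)) 1 * (![_, _, _] : Fin 3 → (w.1.adicCompletion L)) 1) ≤ 1
          simp only [Matrix.cons_val_one]
          simpa using hv11.le
        · simp
        · simp
        · simp
        · show Valued.v ((![_, _, _] : Fin 3 → (w.1.adicCompletion L)) 2 * (![_, _, _] : Fin 3 → (w.1.adicCompletion L)) 2) ≤ 1
          simp only [Matrix.cons_val_two, Matrix.tail_cons, Matrix.head_cons]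
          rw [map_mul, hvσ, hv22, hvz, ← WithZero.exp_add, neg_add_cancel, WithZero.exp_zero]
      refine ⟨(κ * (d * gg⁻¹)) * gg, Set.mul_mem_mul ((cmLocalIntegralLevel L 3 (Matrix.of fun i j : Fin 3 => if i.val + j.val + 1 = 3 then (1 : L) else 0) v).mul_mem hκK hd₀K) (Set.mem_singleton gg), ?_⟩
      rw [QuotientGroup.eq]
      have e : ((κ * (d * gg⁻¹)) * gg)⁻¹ * y = d⁻¹ * b := by rw [hyb]; group
      rw [e]; exact hn'
    rcases le_or_gt n₀ 0 with hle | hgt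
    · refine Or.inl (Set.mem_iUnion.2 ⟨(-n₀).toNat, ?_⟩)
      obtain ⟨dzm, hdzm, hdzm'⟩ := exists_units_coe_eq_torusElt (galAdicCompletionMap (L := L) (IsCMField.complexConj L) hw) (pow_ne_zero (-n₀).toNat hϖ0)
      have hψam : ψ (a ^ (-n₀).toNat) = dzm := Units.ext (by rw [hapow, hdzm, map_pow, inv_pow])
      have hvz : Valued.v (ϖ ^ (-n₀).toNat) = WithZero.exp n₀ := by
        rw [map_pow, hvϖ, ← zpow_natCast, ← WithZero.exp_zsmul, smul_eq_mul, Int.toNat_of_nonneg (by omega)]; congr 1; ring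
      exact key _ _ _ (pow_ne_zero _ hϖ0) hdzm hdzm' hψam hvz
    · refine Or.inr (Set.mem_iUnion₂.2 ⟨n₀.toNat, Finset.mem_Icc.2 ⟨by omega, by omega⟩, ?_⟩)
      have hvz : Valued.v (ϖ⁻¹ ^ n₀.toNat) = WithZero.exp n₀ := by
        rw [map_pow, map_inv₀, hvϖ, ← WithZero.exp_neg, neg_neg, ← zpow_natCast, ← WithZero.exp_zsmul, smul_eq_mul, mul_one,
          Int.toNat_of_nonneg hgt.le]
      exact key _ _ _ (hzpow _) (hdz _) (hdz' _) (hg _) hvz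
  -- ## 4. The measure bound (★ file 1)
  have hA : μ (⋃ mm : ℕ, (QuotientGroup.mk : ((cmDatum L 3 (Matrix.of fun i j : Fin 3 => if i.val + j.val + 1 = 3 then (1 : L) else 0)).Local v) → ((cmDatum L 3 (Matrix.of fun i j : Fin 3 => if i.val + j.val + 1 = 3 then (1 : L) else 0)).Local v) ⧸ Subgroup.centralizer ({u} : Set ((cmDatum L 3 (Matrix.of fun i j : Fin 3 => if i.val + j.val + 1 = 3 then (1 : L) else 0)).Local v))) '' ((cmLocalIntegralLevel L 3 (Matrix.of fun i j : Fin 3 => if i.val + j.val + 1 = 3 then (1 : L) else 0) v : Set ((cmDatum L 3 (Matrix.of fun i j : Fin 3 => if i.val + j.val + 1 = 3 then (1 : L) else 0)).Local v)) * {a ^ mm})) < ⊤ := by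
    have h := measure_iUnion_image_mk_mul_zpow_lt_top (Subgroup.centralizer ({u} : Set ((cmDatum L 3 (Matrix.of fun i j : Fin 3 => if i.val + j.val + 1 = 3 then (1 : L) else 0)).Local v))) ρ μ ν (cmLocalIntegralLevel L 3 (Matrix.of fun i j : Fin 3 => if i.val + j.val + 1 = 3 then (1 : L) else 0) v) hKo hKc a
      hanorm haK hstrict 0
    refine lt_of_le_of_lt (measure_mono fun x hx => ?_) h
    obtain ⟨mm, hmm⟩ := Set.mem_iUnion.1 hx
    exact Set.mem_iUnion₂.2 ⟨(mm : ℤ), by simp, by rwa [zpow_natCast]⟩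
  have hB : μ (⋃ n ∈ Finset.Icc 1 (Mb - nt).toNat,
      (QuotientGroup.mk : ((cmDatum L 3 (Matrix.of fun i j : Fin 3 => if i.val + j.val + 1 = 3 then (1 : L) else 0)).Local v) → ((cmDatum L 3 (Matrix.of fun i j : Fin 3 => if i.val + j.val + 1 = 3 then (1 : L) else 0)).Local v) ⧸ Subgroup.centralizer ({u} : Set ((cmDatum L 3 (Matrix.of fun i j : Fin 3 => if i.val + j.val + 1 = 3 then (1 : L) else 0)).Local v))) '' ((cmLocalIntegralLevel L 3 (Matrix.of fun i j : Fin 3 => if i.val + j.val + 1 = 3 then (1 : L) else 0) v : Set ((cmDatum L 3 (Matrix.of fun i j : Fin 3 => if i.val + j.val + 1 = 3 then (1 : L) else 0)).Local v)) * {g n})) < ⊤ :=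
    measure_biUnion_lt_top (Finset.Icc 1 (Mb - nt).toNat).finite_toSet fun n _ =>
      measure_image_mk_mul_singleton_lt_top (Subgroup.centralizer ({u} : Set ((cmDatum L 3 (Matrix.of fun i j : Fin 3 => if i.val + j.val + 1 = 3 then (1 : L) else 0)).Local v))) ρ μ ν (cmLocalIntegralLevel L 3 (Matrix.of fun i j : Fin 3 => if i.val + j.val + 1 = 3 then (1 : L) else 0) v) hKo hKc (g n)
  exact lt_of_le_of_lt (measure_mono hcover) ((measure_union_le _ _).trans_lt (ENNReal.add_lt_top.2 ⟨hA, hB⟩))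

/-- **RANGA RAO AT THE TRANSVECTION CLASSES — THE RAO CLAUSE AT THE CORNER BASE POINT.**  Same frame: for `u ∈ U(Φ₃)(L⁺_v)` with one-place matrix `n(t₀)`, `t₀ ≠ 0`,
EVERY `G`-invariant measure `μ` on `G ⧸ C(u)` finite on compacta and EVERY `f ∈ C_c^∞(G)` (★ `IsLocSmooth`: locally constant, compactly supported), the orbital
integrand `y C(u) ↦ f(y u y⁻¹)` is `μ`-integrable (★ `integrable_descConj_of_measure_preimage_lt_top` over the finiteness theorem above).  This is clause (iii) of the
organ `stub_ShRao` at the corner representatives; the other transvection representatives and the regular class follow in files 3–4.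
[cite: Rao1972, Theorem p. 505] [cite: Rogawski1990, §4.9 p. 54; §8.1 p. 112] [cite: HarishChandra1999AdmissibleDistributions, §3.1 p. 17] -/
theorem UnitaryGroup.integrable_descConj_of_isLocSmooth_of_coe_eq_cornerUnipotent
    (L : Type) [Field L] [NumberField L] [IsCMField L] (v : HeightOneSpectrum (𝓞 ↥(maximalRealSubfield L)))
    (w : PlacesOver L v) (hw : IsCMField.complexConj L • w.1 = w.1)
    [MeasurableSpace ((cmDatum L 3 (Matrix.of fun i j : Fin 3 => if i.val + j.val + 1 = 3 then (1 : L) else 0)).Local v)] [BorelSpace ((cmDatum L 3 (Matrix.of fun i j : Fin 3 => if i.val + j.val + 1 = 3 then (1 : L) else 0)).Local v)]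
    [∀ γ : ((cmDatum L 3 (Matrix.of fun i j : Fin 3 => if i.val + j.val + 1 = 3 then (1 : L) else 0)).Local v), MeasurableSpace (((cmDatum L 3 (Matrix.of fun i j : Fin 3 => if i.val + j.val + 1 = 3 then (1 : L) else 0)).Local v) ⧸ Subgroup.centralizer ({γ} : Set ((cmDatum L 3 (Matrix.of fun i j : Fin 3 => if i.val + j.val + 1 = 3 then (1 : L) else 0)).Local v)))]
    [∀ γ : ((cmDatum L 3 (Matrix.of fun i j : Fin 3 => if i.val + j.val + 1 = 3 then (1 : L) else 0)).Local v), BorelSpace (((cmDatum L 3 (Matrix.of fun i j : Fin 3 => if i.val + j.val + 1 = 3 then (1 : L) else 0)).Local v) ⧸ Subgroup.centralizer ({γ} : Set ((cmDatum L 3 (Matrix.of fun i j : Fin 3 => if i.val + j.val + 1 = 3 then (1 : L) else 0)).Local v)))]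
    (u : ((cmDatum L 3 (Matrix.of fun i j : Fin 3 => if i.val + j.val + 1 = 3 then (1 : L) else 0)).Local v)) {t₀ : w.1.adicCompletion L} (ht₀ : t₀ ≠ 0)
    (hu : (((localNonsplitEquiv (IsCMField.complexConj L) (Matrix.of fun i j : Fin 3 => if i.val + j.val + 1 = 3 then (1 : L) else 0)
        (IsCMField.complexConj_ne_one L) w hw u :
          ↥(unitaryGroupOfForm (galAdicCompletionMap (L := L) (IsCMField.complexConj L) hw)
            (placeForm (Matrix.of fun i j : Fin 3 => if i.val + j.val + 1 = 3 then (1 : L) else 0) w.1))) : GL (Fin 3) (w.1.adicCompletion L)) :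
        Matrix (Fin 3) (Fin 3) (w.1.adicCompletion L)) = !![1, 0, t₀; 0, 1, 0; 0, 0, 1])
    (μ : Measure (((cmDatum L 3 (Matrix.of fun i j : Fin 3 => if i.val + j.val + 1 = 3 then (1 : L) else 0)).Local v) ⧸ Subgroup.centralizer ({u} : Set ((cmDatum L 3 (Matrix.of fun i j : Fin 3 => if i.val + j.val + 1 = 3 then (1 : L) else 0)).Local v))))
    [SMulInvariantMeasure ((cmDatum L 3 (Matrix.of fun i j : Fin 3 => if i.val + j.val + 1 = 3 then (1 : L) else 0)).Local v) _ μ] [IsFiniteMeasureOnCompacts μ]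
    (f : ((cmDatum L 3 (Matrix.of fun i j : Fin 3 => if i.val + j.val + 1 = 3 then (1 : L) else 0)).Local v) → ℂ) (hf : IsLocSmooth f) :
    Integrable (descConj u (Subgroup.centralizer ({u} : Set ((cmDatum L 3 (Matrix.of fun i j : Fin 3 => if i.val + j.val + 1 = 3 then (1 : L) else 0)).Local v))) (fun _ hg => Subgroup.mem_centralizer_singleton_iff.1 hg) f) μ :=
  integrable_descConj_of_measure_preimage_lt_top u _ _ μ
    (fun _ hC => UnitaryGroup.measure_preimage_descConj_lt_top_of_coe_eq_cornerUnipotent L v w hw u ht₀ hu μ hC) hf.continuous hf.hasCompactSupport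

end Literature.NumberTheory.Rogawski1990

end
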